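import Literature.NumberTheory.Transcendental.KZFibredRelations
import Literature.NumberTheory.Transcendental.PeriodConjecture
import Literature.NumberTheory.Transcendental.KZKernelConjectureForms
import Literature.NumberTheory.Transcendental.KZDominatedFamily
import Summits.KontsevichZagierPeriods.KontsevichZagierPeriods.Statement
import Summits.KontsevichZagierPeriods.KontsevichZagierPeriods.Theorems.ValuedFieldSpecialisationParametricLiftingSliceValueElementaryFamily
import Summits.KontsevichZagierPeriods.KontsevichZagierPeriods.Theorems.ValuedFieldSpecialisationClassLevelExpansionFibreDimOneElementaryB
import Summits.KontsevichZagierPeriods.KontsevichZagierPeriods.Theorems.ValuedFieldSpecialisationParametricLiftingDivergentMonomialsCoeff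

/-!
# Route ValuedFieldSpecialisation — crux `ParametricLifting` (stmt-KontsevichZagierPeriods-3498),
line `registered`/birth: THE STRENGTH OF STUB S3b `stub_coefficientClasses_mem_relations`

Helper (`--supports`) for item stmt-KontsevichZagierPeriods-3498. The line "regularise, then
remove the resonances" derives resonance removal (S3) from fibred product functoriality (S3a,
landed: `stub_elementaryNet_mem_fibredRelations`) and the stub S3b: *if the slices of an elementary
divergent net `D = Σ mᵢ [Pᵢ]` vanish on `(0,1)`, then every monomial group's coefficient class
`Σ_{i : pᵢ/qᵢ = p₀/q₀, bᵢ = b₀} mᵢ [ρᵢ]` lies in `KZ.relations`*. This file proves that S3b, taken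
VERBATIM as registered (inlined below as a hypothesis / conclusion; no new definition), is
EQUIVALENT to the Kontsevich–Zagier kernel conjecture
`Literature.NumberTheory.Transcendental.KZKernelConjecture` (itself equivalent to the summit,
`kzKernelConjecture_iff_isRational`):

* `equivalent_of_coefficientClasses_mem_relations` — S3b ⇒ equal-valued representations of a common
  dimension are KZ-equivalent: specialise to `k = 2`, `m = (1, -1)`, one monomial type
  `(p, q, b) = (1, 2, 0)`, `Pᵢ` the elementary divergent products over `ρᵢ` (`exists_elementaryRep`);
  the slice hypothesis holds by the landed slice formula `stub_sliceValue_elementaryFamily`.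
* `kzKernelConjecture_of_coefficientClasses_mem_relations` — S3b ⇒ `KZKernelConjecture` (pad to a
  common dimension with `KZ.IntegralRep.exists_equivalent_of_le`, then
  `KZKernelConjecture.of_kzPeriodConjecture'`).
* `coefficientClasses_mem_relations_of_kzKernelConjecture` — the converse: by the landed slice
  formula and grouped-coefficient lemma (`stub_divergentMonomials_coeff_eq_zero`, along `𝓝[>] 0`)
  the slice hypothesis gives `KZ.eval (Σ_group mᵢ [ρᵢ]) = 0`, and the kernel conjecture concludes.
* `coefficientClasses_mem_relations_iff_kzKernelConjecture` — the equivalence.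
* `regularisedLifting_of_kontsevichZagierPeriods` — the other residual stub S1 (regularised lifting) is implied
  by the summit (empty divergent part, `H = 0`).

Consequence for the line (recorded in `Cruxes/ParametricLifting/Lines/`): closing the birth skeleton
through S3b is exactly as hard as the summit; the `ρᵢ` of the elementary encoding range over all
dimensions, so no induction "one level down" is available inside the registered statement.

Sources: M. Kontsevich, D. Zagier, *Periods* (2001), §1.2, Conjecture 1; A. Huber,
S. Müller-Stach, *Periods and Nori Motives* (2017), Conj. 13.2.1 (kernel form). The stub and the
elementary encoding are this route's. Deliberately NOT here: anything conditional on the conjecture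
beyond the converse direction (which is recorded only to pin the stub's exact strength).
-/

noncomputable section

namespace Summit.KontsevichZagierPeriods.ValuedFieldSpecialisation

open MeasureTheory Set Filter
open scoped Topology
open Literature.NumberTheory.Transcendental

/-- **Stub S3b ⇒ equal-valued representations of a common dimension are KZ-equivalent.** With the
registered statement of `stub_coefficientClasses_mem_relations` as hypothesis: specialise to
`k = 2`, `m = (1, -1)`, monomial type `(p, q, b) = (1, 2, 0)` and the elementary divergent products
`P₁, P₂` over `ρ₁, ρ₂` (`exists_elementaryRep`); the slice hypothesis holds by the slice formula
`stub_sliceValue_elementaryFamily` and `ρ₁.value = ρ₂.value`, and the single monomial group is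
everything, so the conclusion reads `[ρ₁] − [ρ₂] ∈ KZ.relations`.
[Kontsevich–Zagier 2001, §1.2 Conjecture 1] [folklore] -/
theorem equivalent_of_coefficientClasses_mem_relations
    (h : ∀ (k : ℕ) (m : Fin k → ℤ) (p q b d : Fin k → ℕ) (ρ : (i : Fin k) → KZ.IntegralRep (d i)) (P : (i : Fin k) → KZ.IntegralRep (b i + d i + 1 + 1)), (∀ i, 0 < q i ∧ p i < q i ∧ (0 < p i ∨ 0 < b i) ∧ (P i).domain = {z | ∃ (s u : ℝ) (y : Fin (b i) → ℝ) (w : Fin (d i) → ℝ), z = Matrix.vecCons s (Matrix.vecCons u (Fin.append y w)) ∧ 0 < s ∧ s < 1 ∧ 0 < u ∧ u ^ (q i) * s ^ (p i) < 1 ∧ (∀ j, s ≤ y j ∧ y j ≤ 1) ∧ w ∈ (ρ i).domain} ∧ (P i).integrand = fun z => (∏ j : Fin (b i), (z (Fin.castAdd (d i) j).succ.succ)⁻¹) * (ρ i).integrand (fun l : Fin (d i) => z (Fin.natAdd (b i) l).succ.succ)) → (∀ s ∈ Set.Ioo (0 : ℝ) 1, KZ.sliceEval (∑ i, m i • KZ.of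 (P i)) s = 0) → ∀ i₀ : Fin k, (∑ i ∈ Finset.univ.filter (fun i => (p i / q i : ℝ) = (p i₀ / q i₀ : ℝ) ∧ b i = b i₀), m i • KZ.of (ρ i)) ∈ KZ.relations) :
    ∀ (d : ℕ) (ρ₁ ρ₂ : KZ.IntegralRep d), ρ₁.value = ρ₂.value →
      KZ.of ρ₁ - KZ.of ρ₂ ∈ KZ.relations := by
  intro n ρ₁ ρ₂ hv
  obtain ⟨P₁, hP₁d, hP₁i⟩ := exists_elementaryRep (p := 1) (q := 2) (b := 0) one_lt_two ρ₁
  obtain ⟨P₂, hP₂d, hP₂i⟩ := exists_elementaryRep (p := 1) (q := 2) (b := 0) one_lt_two ρ₂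
  have key := h 2 ![1, -1] (fun _ => 1) (fun _ => 2) (fun _ => 0) (fun _ => n)
    (fun i => ![ρ₁, ρ₂] i) (fun i => ![P₁, P₂] i) ?_ ?_ 0
  · -- the monomial group of `0` is everything; the sum is `[ρ₁] - [ρ₂]`
    simpa [Fin.sum_univ_two, sub_eq_add_neg] using key
  · -- the elementary clauses
    refine Fin.forall_fin_two.mpr ⟨?_, ?_⟩
    · simp only [Matrix.cons_val_zero]
      exact ⟨two_pos, one_lt_two, Or.inl one_pos, hP₁d, hP₁i⟩
    · simp only [Matrix.cons_val_one]
      exact ⟨two_pos, one_lt_two, Or.inl one_pos, hP₂d, hP₂i⟩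
  · -- the slice hypothesis, by the slice formula and `ρ₁.value = ρ₂.value`
    intro s hs
    have h₁ := stub_sliceValue_elementaryFamily 1 2 0 n ρ₁ P₁ two_pos hP₁d hP₁i s hs
    have h₂ := stub_sliceValue_elementaryFamily 1 2 0 n ρ₂ P₂ two_pos hP₂d hP₂i s hs
    simp only [Fin.sum_univ_two, Matrix.cons_val_zero, Matrix.cons_val_one,
      one_zsmul, neg_one_zsmul, map_add, map_neg, KZ.sliceEval_of, Pi.add_apply, Pi.neg_apply,
      h₁, h₂, hv, add_neg_cancel]

/-- **Stub S3b ⇒ the Kontsevich–Zagier kernel conjecture.** From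
`equivalent_of_coefficientClasses_mem_relations`: pad two equal-valued representations of any
dimensions to a common dimension (`KZ.IntegralRep.exists_equivalent_of_le`, value preserved by
soundness `KZ.relations_le_ker_eval_holds`) to get the two-representation form
`KZPeriodConjecture'`, then `KZKernelConjecture.of_kzPeriodConjecture'`. So the registered stub is
at least summit-strength. [Kontsevich–Zagier 2001, §1.2 Conjecture 1; Huber–Müller-Stach 2017,
Conj. 13.2.1] [folklore] -/
theorem kzKernelConjecture_of_coefficientClasses_mem_relations
    (h : ∀ (k : ℕ) (m : Fin k → ℤ) (p q b d : Fin k → ℕ) (ρ : (i : Fin k) → KZ.IntegralRep (d i)) (P : (i : Fin k) → KZ.IntegralRep (b i + d i + 1 + 1)), (∀ i, 0 < q i ∧ p i < q i ∧ (0 < p i ∨ 0 < b i) ∧ (P i).domain = {z | ∃ (s u : ℝ) (y : Fin (b i) → ℝ) (w : Fin (d i) → ℝ), z = Matrix.vecCons s (Matrix.vecCons u (Fin.append y w)) ∧ 0 < s ∧ s < 1 ∧ 0 < u ∧ u ^ (q i) * s ^ (p i) < 1 ∧ (∀ j, s ≤ y j ∧ y j ≤ 1) ∧ w ∈ (ρ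 i).domain} ∧ (P i).integrand = fun z => (∏ j : Fin (b i), (z (Fin.castAdd (d i) j).succ.succ)⁻¹) * (ρ i).integrand (fun l : Fin (d i) => z (Fin.natAdd (b i) l).succ.succ)) → (∀ s ∈ Set.Ioo (0 : ℝ) 1, KZ.sliceEval (∑ i, m i • KZ.of (P i)) s = 0) → ∀ i₀ : Fin k, (∑ i ∈ Finset.univ.filter (fun i => (p i / q i : ℝ) = (p i₀ / q i₀ : ℝ) ∧ b i = b i₀), m i • KZ.of (ρ i)) ∈ KZ.relations) :
    KZKernelConjecture := by
  refine KZKernelConjecture.of_kzPeriodConjecture' ?_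
  intro n m r r' hv
  obtain ⟨R, hR⟩ := r.exists_equivalent_of_le (le_max_left n m)
  obtain ⟨R', hR'⟩ := r'.exists_equivalent_of_le (le_max_right n m)
  have h1 := KZ.relations_le_ker_eval_holds hR
  have h2 := KZ.relations_le_ker_eval_holds hR'
  rw [AddMonoidHom.mem_ker, KZ.eval_of_sub_of, sub_eq_zero] at h1 h2
  have hvR : R.value = R'.value := by rw [← h1, ← h2, hv]
  have key : KZ.of R - KZ.of R' ∈ KZ.relations :=
    equivalent_of_coefficientClasses_mem_relations h (max n m) R R' hvR
  have e : KZ.of r - KZ.of r' =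
      (KZ.of r - KZ.of R) + (KZ.of R - KZ.of R') - (KZ.of r' - KZ.of R') := by abel
  show KZ.of r - KZ.of r' ∈ KZ.relations
  rw [e]
  exact KZ.relations.sub_mem (KZ.relations.add_mem hR key) hR'

/-- **The kernel conjecture ⇒ stub S3b** (the converse, pinning the stub's strength exactly): the
slice hypothesis forces every grouped coefficient `Σ_group mᵢ (ρᵢ).value = KZ.eval (Σ_group mᵢ [ρᵢ])`
to vanish — slice formula `stub_sliceValue_elementaryFamily` (`aᵢ = −pᵢ/qᵢ`,
`wᵢ = mᵢ (−1)^{bᵢ} (ρᵢ).value`, divergent since `qᵢ > 0 ∧ (pᵢ > 0 ∨ bᵢ > 0)`) and the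
grouped-coefficient lemma `stub_divergentMonomials_coeff_eq_zero` along `𝓝[>] 0` with limit `0` —
and the kernel conjecture concludes. [Kontsevich–Zagier 2001, §1.2 Conjecture 1] [folklore] -/
theorem coefficientClasses_mem_relations_of_kzKernelConjecture (hK : KZKernelConjecture) :
    ∀ (k : ℕ) (m : Fin k → ℤ) (p q b d : Fin k → ℕ) (ρ : (i : Fin k) → KZ.IntegralRep (d i)) (P : (i : Fin k) → KZ.IntegralRep (b i + d i + 1 + 1)), (∀ i, 0 < q i ∧ p i < q i ∧ (0 < p i ∨ 0 < b i) ∧ (P i).domain = {z | ∃ (s u : ℝ) (y : Fin (b i) → ℝ) (w : Fin (d i) → ℝ), z = Matrix.vecCons s (Matrix.vecCons u (Fin.append y w)) ∧ 0 < s ∧ s < 1 ∧ 0 < u ∧ u ^ (q i) * s ^ (p i) < 1 ∧ (∀ j, s ≤ y j ∧ y j ≤ 1) ∧ w ∈ (ρ i).domain} ∧ (P i).integrand = fun z => (∏ j : Fin (b i), (z (Fin.castAdd (d i) j).succ.succ)⁻¹) * (ρ i).integrand (fun l : Fin (d i) => z (Fin.natAdd (b i) l).succ.succ)) → (∀ s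 ∈ Set.Ioo (0 : ℝ) 1, KZ.sliceEval (∑ i, m i • KZ.of (P i)) s = 0) → ∀ i₀ : Fin k, (∑ i ∈ Finset.univ.filter (fun i => (p i / q i : ℝ) = (p i₀ / q i₀ : ℝ) ∧ b i = b i₀), m i • KZ.of (ρ i)) ∈ KZ.relations := by
  intro k m p q b d ρ P hP hslice i₀
  apply hK
  simp only [map_sum, map_zsmul, KZ.eval_of, zsmul_eq_mul]
  have hcoef := stub_divergentMonomials_coeff_eq_zero k (fun i => -(p i / q i : ℝ)) b
    (fun i => (m i : ℝ) * (-1) ^ (b i) * (ρ i).value) (𝓝[>] (0 : ℝ)) 0 inferInstance le_rfl ?_ ?_ i₀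
  · beta_reduce at hcoef
    have hfilt : (Finset.univ.filter fun i => -(p i / q i : ℝ) = -(p i₀ / q i₀ : ℝ) ∧ b i = b i₀) =
        Finset.univ.filter fun i => (p i / q i : ℝ) = (p i₀ / q i₀ : ℝ) ∧ b i = b i₀ := by
      refine Finset.filter_congr fun i _ => ?_
      rw [neg_inj]
    rw [hfilt] at hcoef
    have hfac : ∑ i ∈ Finset.univ.filter (fun i => (p i / q i : ℝ) = (p i₀ / q i₀ : ℝ) ∧ b i = b i₀),
        (m i : ℝ) * (-1) ^ (b i) * (ρ i).value =
        (-1) ^ (b i₀) * ∑ i ∈ Finset.univ.filter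
          (fun i => (p i / q i : ℝ) = (p i₀ / q i₀ : ℝ) ∧ b i = b i₀), (m i : ℝ) * (ρ i).value := by
      rw [Finset.mul_sum]
      refine Finset.sum_congr rfl fun i hi => ?_
      obtain ⟨-, -, hb⟩ := Finset.mem_filter.mp hi
      rw [hb]; ring
    rw [hfac, mul_eq_zero] at hcoef
    exact hcoef.resolve_left (pow_ne_zero _ (by norm_num))
  · intro i
    obtain ⟨hq, -, hpb, -, -⟩ := hP i
    rcases Nat.eq_zero_or_pos (p i) with hp | hp
    · right
      exact ⟨by simp [hp], hpb.resolve_left (by omega)⟩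
    · left
      have : (0 : ℝ) < p i / q i := div_pos (Nat.cast_pos.mpr hp) (Nat.cast_pos.mpr hq)
      linarith
  · refine (tendsto_const_nhds (x := (0 : ℝ))).congr' ?_
    filter_upwards [(Ioo_mem_nhdsGT one_pos : Ioo (0 : ℝ) 1 ∈ 𝓝[>] (0 : ℝ))] with s hs
    have h0 := hslice s hs
    simp only [map_sum, map_zsmul, KZ.sliceEval_of, Finset.sum_apply, Pi.smul_apply] at h0
    simp only [zsmul_eq_mul] at h0
    rw [eq_comm, ← h0]
    refine Finset.sum_congr rfl fun i _ => ?_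
    obtain ⟨hq, -, -, hdom, hint⟩ := hP i
    rw [stub_sliceValue_elementaryFamily (p i) (q i) (b i) (d i) (ρ i) (P i) hq hdom hint s hs,
      neg_eq_neg_one_mul (Real.log s), mul_pow]
    ring

/-- **Stub S3b of the line is EQUIVALENT to the Kontsevich–Zagier kernel conjecture** (hence to the
summit): `kzKernelConjecture_of_coefficientClasses_mem_relations` and
`coefficientClasses_mem_relations_of_kzKernelConjecture`. [Kontsevich–Zagier 2001, §1.2
Conjecture 1] [folklore] -/
theorem coefficientClasses_mem_relations_iff_kzKernelConjecture :
    (∀ (k : ℕ) (m : Fin k → ℤ) (p q b d : Fin k → ℕ) (ρ : (i : Fin k) → KZ.IntegralRep (d i)) (P : (i : Fin k) → KZ.IntegralRep (b i + d i + 1 + 1)), (∀ i, 0 < q i ∧ p i < q i ∧ (0 < p i ∨ 0 < b i) ∧ (P i).domain = {z | ∃ (s u : ℝ) (y : Fin (b i) → ℝ) (w : Fin (d i) → ℝ), z = Matrix.vecCons s (Matrix.vecCons u (Fin.append y w)) ∧ 0 < s ∧ s < 1 ∧ 0 < u ∧ u ^ (q i) * s ^ (p i) < 1 ∧ (∀ j,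 s ≤ y j ∧ y j ≤ 1) ∧ w ∈ (ρ i).domain} ∧ (P i).integrand = fun z => (∏ j : Fin (b i), (z (Fin.castAdd (d i) j).succ.succ)⁻¹) * (ρ i).integrand (fun l : Fin (d i) => z (Fin.natAdd (b i) l).succ.succ)) → (∀ s ∈ Set.Ioo (0 : ℝ) 1, KZ.sliceEval (∑ i, m i • KZ.of (P i)) s = 0) → ∀ i₀ : Fin k, (∑ i ∈ Finset.univ.filter (fun i => (p i / q i : ℝ) = (p i₀ / q i₀ : ℝ) ∧ b i = b i₀), m i • KZ.of (ρ i)) ∈ KZ.relations) ↔ Literature.NumberTheory.Transcendental.KZKernelConjecture :=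
  ⟨kzKernelConjecture_of_coefficientClasses_mem_relations,
    coefficientClasses_mem_relations_of_kzKernelConjecture⟩

/-! ### The other residual stub: S1 is implied by the summit -/

/-- **Stub S1 (`stub_regularisedLifting`, regularised lifting) is implied by the summit**: under
`KontsevichZagierPeriods` take the EMPTY divergent part and the EMPTY dominated net (`k = k₂ = 0`)
and `H = 0 ∈ KZ.fibredRelations`; the special-fibre condition is `-( [r] - [r'] ) ∈ KZ.relations`,
i.e. the conjecture for the pair. Together with
`coefficientClasses_mem_relations_iff_kzKernelConjecture` this pins both residual stubs of the
line `registered` at summit strength (S1 at most, S3b exactly). [Kontsevich–Zagier 2001, §1.2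
Conjecture 1] [folklore] -/
theorem regularisedLifting_of_kontsevichZagierPeriods (hKZ : KontsevichZagierPeriods) :
    ∀ ⦃n n' : ℕ⦄ (r : KZ.IntegralRep n) (r' : KZ.IntegralRep n'), r.IsRational → r'.IsRational → r.value = r'.value → ∃ H ∈ KZ.fibredRelations, ∃ (k : ℕ) (m : Fin k → ℤ) (p q b d : Fin k → ℕ) (ρ : (i : Fin k) → KZ.IntegralRep (d i)) (P : (i : Fin k) → KZ.IntegralRep (b i + d i + 1 + 1)) (k₂ : ℕ) (d₂ : Fin k₂ → ℕ) (m₂ : Fin k₂ → ℤ) (R : (j : Fin k₂) → KZ.IntegralRep (d₂ j + 1)) (r₀ g : (j : Fin k₂) → KZ.IntegralRep (d₂ j)), (∀ i, 0 < q i ∧ p i < q i ∧ (0 < p i ∨ 0 < b i) ∧ (P i).domain = {z | ∃ (s u : ℝ) (y : Fin (b i) → ℝ) (w : Fin (d i) → ℝ), z = Matrix.vecCons s (Matrix.vecCons u (Fin.append y w)) ∧ 0 < s ∧ s < 1 ∧ 0 < u ∧ u ^ (q i) * s ^ (p i) < 1 ∧ (∀ j, s ≤ y j ∧ y j ≤ 1)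 ∧ w ∈ (ρ i).domain} ∧ (P i).integrand = fun z => (∏ j : Fin (b i), (z (Fin.castAdd (d i) j).succ.succ)⁻¹) * (ρ i).integrand (fun l : Fin (d i) => z (Fin.natAdd (b i) l).succ.succ)) ∧ (∀ j, KZ.IsDominatedFamily (R j) (r₀ j) (g j)) ∧ H = (∑ i, m i • KZ.of (P i)) + (∑ j, m₂ j • KZ.of (R j)) ∧ (∑ j, m₂ j • KZ.of (r₀ j)) - (KZ.of r - KZ.of r') ∈ KZ.relations := by
  intro n n' r r' hr hr' hv
  refine ⟨0, KZ.fibredRelations.zero_mem, 0, Fin.elim0, Fin.elim0, Fin.elim0, Fin.elim0, Fin.elim0,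
    fun i => i.elim0, fun i => i.elim0, 0, Fin.elim0, Fin.elim0, fun j => j.elim0, fun j => j.elim0,
    fun j => j.elim0, fun i => i.elim0, fun j => j.elim0, by simp, ?_⟩
  simp only [Finset.univ_eq_empty, Finset.sum_empty, zero_sub]
  exact KZ.relations.neg_mem (hKZ r r' hr hr' hv)

end Summit.KontsevichZagierPeriods.ValuedFieldSpecialisation
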